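import Summits.ResolutionOfSingularities.ResolutionOfSingularities.Theorems.FrobeniusClosingSteerEtaleResidueLift
import HarnessLib

/-!
# [OURS · L0 W4.1] K3-a (part 3): FUNCTORIALITY of the étale residue enlargement — `S ⊆ S′ ↦ (S[X]/(P))_𝔫 ↪ (S′[X]/(P))_𝔫′`
# (chain W4.1 `FrobeniusClosingSteer`, crux stmt-ResolutionOfSingularities-16345; K3 route (R1), RULING 250(a); `--supports … --as helper`)

HONEST FRAMING. OURS kernel (HIRONAKA-L librarian res-D-lib-1 gen 7), continuing `…SteerEtaleResidueLift` (p557242/p557933). For an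
injective ring map `f : S → S′` and a monic `P ∈ S[X]`:

* `liftMap_injective` — the change-of-rings map `ι : S[X]/(P) → S′[X]/(P)` (root ↦ root) is injective (division by the monic `P`);
* `ker_le_of_le` — for a prime `𝔫` of a ring `A` with `A_𝔫` a domain, `ker (A → A_𝔫)` is contained in every prime `𝔮 ≤ 𝔫`;
* `localization_map_injective` — **the induced local map `(S[X]/(P))_𝔫 → (S′[X]/(P))_𝔫′` (`𝔫 = ι⁻¹ 𝔫′`) is INJECTIVE** when both
  localisations are domains and `S′ → (S′[X]/(P))_𝔫′` is injective: the kernels of `A → A_𝔫` and of `A → A′ → A′_𝔫′` are primes of `A` inside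
  `𝔫` over `(0) ⊂ S`, comparable, hence equal by INCOMPARABILITY for the integral extension `S ⊂ S[X]/(P)` (Mathlib
  `Ideal.IsIntegral.comap_lt_comap`).

This is what makes the upstairs window `S′₀ ≤ S′₁ ≤ S′₂ ≤ S′₃ ⊂ L′ := Frac (S₃[X]/(P))_𝔫₃` of the K3 base change honest subrings of ONE
field (design `D/res-D-lib-1/K3-BLUEPRINT.md`). Nothing here is a statement of H. Hironaka's manuscript [Hironaka2017]. AI-written; AI
review is weaker than expert review. [cite: StacksProject, Tag 00TV]
-/

set_option linter.dupNamespace false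

noncomputable section

namespace Summit.ResolutionOfSingularities.ResolutionOfSingularities.Theorems.SwitchingDichotomy.EtaleLift

open IsLocalRing Polynomial

universe u

variable {S S' : Type u} [CommRing S] [CommRing S'] (f : S →+* S') (P : S[X])

/-! ## §A The change-of-rings map `S[X]/(P) → S′[X]/(P)` -/

/-- The root of `P.map f` in `S′[X]/(P.map f)` is a root of `P` read through `f`. [folklore] -/
theorem eval₂_root_map_eq_zero :
    P.eval₂ ((AdjoinRoot.of (P.map f)).comp f) (AdjoinRoot.root (P.map f)) = 0 := by
  rw [← Polynomial.eval₂_map, AdjoinRoot.eval₂_root]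

/-- The change-of-rings map on a class: `ι (mk q) = mk (q.map f)`. [folklore] -/
theorem lift_mk_eq_mk_map (q : S[X]) :
    AdjoinRoot.lift ((AdjoinRoot.of (P.map f)).comp f) (AdjoinRoot.root (P.map f)) (eval₂_root_map_eq_zero f P)
      (AdjoinRoot.mk P q) = AdjoinRoot.mk (P.map f) (q.map f) := by
  rw [AdjoinRoot.lift_mk, ← Polynomial.eval₂_map, ← AdjoinRoot.algebraMap_eq, ← Polynomial.aeval_def, AdjoinRoot.aeval_eq]

/-- The change-of-rings map is compatible with the structure maps: `ι ∘ (S → S[X]/(P)) = (S′ → S′[X]/(P)) ∘ f`. [folklore] -/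
theorem lift_comp_of :
    (AdjoinRoot.lift ((AdjoinRoot.of (P.map f)).comp f) (AdjoinRoot.root (P.map f)) (eval₂_root_map_eq_zero f P)).comp
      (AdjoinRoot.of P) = (AdjoinRoot.of (P.map f)).comp f := by
  ext s
  rw [RingHom.comp_apply, AdjoinRoot.lift_of]

/-- **Injectivity of `S[X]/(P) → S′[X]/(P)`** for `f : S → S′` injective and `P` monic (division by `P`). [folklore] -/
theorem liftMap_injective [Nontrivial S'] (hf : Function.Injective f) (hP : P.Monic) :
    Function.Injective
      (AdjoinRoot.lift ((AdjoinRoot.of (P.map f)).comp f) (AdjoinRoot.root (P.map f)) (eval₂_root_map_eq_zero f P)) := by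
  haveI : Nontrivial S := f.domain_nontrivial
  rw [injective_iff_map_eq_zero]
  intro a ha
  obtain ⟨q, rfl⟩ := AdjoinRoot.mk_surjective a
  rw [lift_mk_eq_mk_map, AdjoinRoot.mk_eq_zero, ← Polynomial.modByMonic_eq_zero_iff_dvd (hP.map f),
    ← Polynomial.map_modByMonic f hP, Polynomial.map_eq_zero_iff hf] at ha
  rw [AdjoinRoot.mk_eq_zero, ← Polynomial.modByMonic_eq_zero_iff_dvd hP]
  exact ha

/-! ## §B The kernel of `A → A_𝔫` when `A_𝔫` is a domain -/

/-- For a prime `𝔫` with `A_𝔫` a domain, `ker (A → A_𝔫)` lies inside every prime `𝔮 ≤ 𝔫`. [folklore] -/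
theorem ker_le_of_le {A : Type u} [CommRing A] (𝔫 : Ideal A) [𝔫.IsPrime] (𝔮 : Ideal A) [𝔮.IsPrime] (hle : 𝔮 ≤ 𝔫) :
    RingHom.ker (algebraMap A (Localization.AtPrime 𝔫)) ≤ 𝔮 := by
  intro a ha
  rw [RingHom.mem_ker, IsLocalization.map_eq_zero_iff 𝔫.primeCompl] at ha
  obtain ⟨⟨u, hu⟩, hua⟩ := ha
  have hu' : u ∉ 𝔮 := fun h => hu (hle h)
  have hmem : u * a ∈ 𝔮 := by rw [hua]; exact Ideal.zero_mem _
  exact (Ideal.IsPrime.mem_or_mem ‹𝔮.IsPrime› hmem).resolve_left hu'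

/-! ## §C Injectivity of the induced local map -/

/-- **Injectivity upstairs.** Let `f : S → S′` be injective, `P ∈ S[X]` monic, `A := S[X]/(P)`, `B` an `S′`-algebra with a ring map
`ι : A → B` compatible with the structure maps, `𝔫′` a prime of `B` and `𝔫 := ι⁻¹ 𝔫′`. If `A_𝔫` and `B_𝔫′` are DOMAINS and `S′ → B_𝔫′` is
injective, then any ring map `g : A_𝔫 → B_𝔫′` over `ι` is injective. (The kernels of `A → B_𝔫′` and of `A → A_𝔫` are primes of `A` inside
`𝔫` lying over `(0)` of `S`; the latter is the least prime inside `𝔫`, and INCOMPARABILITY for the integral extension `S ⊂ A` makes them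
equal.) Used with `B := S′[X]/(P)`. [cite: StacksProject, Tag 00TV] -/
theorem localization_map_injective [Nontrivial S'] (hf : Function.Injective f) (hP : P.Monic)
    {B : Type u} [CommRing B] [Algebra S' B] (ι : AdjoinRoot P →+* B)
    (hι : ι.comp (algebraMap S (AdjoinRoot P)) = (algebraMap S' B).comp f)
    (𝔫' : Ideal B) [𝔫'.IsPrime] [IsDomain (Localization.AtPrime 𝔫')] [IsDomain (Localization.AtPrime (𝔫'.comap ι))]
    (hinj' : Function.Injective (algebraMap S' (Localization.AtPrime 𝔫')))
    (g : Localization.AtPrime (𝔫'.comap ι) →+* Localization.AtPrime 𝔫')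
    (hg : g.comp (algebraMap (AdjoinRoot P) (Localization.AtPrime (𝔫'.comap ι))) =
      (algebraMap B (Localization.AtPrime 𝔫')).comp ι) :
    Function.Injective g := by
  haveI : Nontrivial S := f.domain_nontrivial
  haveI : Module.Finite S (AdjoinRoot P) := hP.finite_adjoinRoot
  haveI : Algebra.IsIntegral S (AdjoinRoot P) := inferInstance
  -- the two kernels
  haveI h𝔮p : (RingHom.ker (algebraMap (AdjoinRoot P) (Localization.AtPrime (𝔫'.comap ι)))).IsPrime := RingHom.ker_isPrime _
  haveI h𝔯p : (RingHom.ker ((algebraMap B (Localization.AtPrime 𝔫')).comp ι)).IsPrime := RingHom.ker_isPrime _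
  have h𝔯le : RingHom.ker ((algebraMap B (Localization.AtPrime 𝔫')).comp ι) ≤ 𝔫'.comap ι := by
    intro a ha
    rw [RingHom.mem_ker, RingHom.comp_apply] at ha
    rw [Ideal.mem_comap]
    by_contra hnot
    have hunit : IsUnit (algebraMap B (Localization.AtPrime 𝔫') (ι a)) :=
      IsLocalization.map_units (Localization.AtPrime 𝔫') (⟨ι a, hnot⟩ : 𝔫'.primeCompl)
    rw [ha] at hunit
    exact not_isUnit_zero hunit
  have h𝔮le : RingHom.ker (algebraMap (AdjoinRoot P) (Localization.AtPrime (𝔫'.comap ι))) ≤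
      RingHom.ker ((algebraMap B (Localization.AtPrime 𝔫')).comp ι) := ker_le_of_le _ _ h𝔯le
  -- both contract to `(0)` in `S`
  have h𝔯S : (RingHom.ker ((algebraMap B (Localization.AtPrime 𝔫')).comp ι)).comap (algebraMap S (AdjoinRoot P)) = ⊥ := by
    refine le_bot_iff.mp fun s hs => ?_
    rw [Ideal.mem_comap, RingHom.mem_ker, RingHom.comp_apply] at hs
    have h1 : ι (algebraMap S (AdjoinRoot P) s) = algebraMap S' B (f s) := by
      rw [← RingHom.comp_apply, hι, RingHom.comp_apply]
    rw [h1, ← IsScalarTower.algebraMap_apply] at hs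
    have : f s = 0 := hinj' (by rw [hs, map_zero])
    exact (Ideal.mem_bot).mpr (hf (by rw [this, map_zero]))
  have h𝔮S : (RingHom.ker (algebraMap (AdjoinRoot P) (Localization.AtPrime (𝔫'.comap ι)))).comap
      (algebraMap S (AdjoinRoot P)) = ⊥ :=
    le_bot_iff.mp ((Ideal.comap_mono h𝔮le).trans h𝔯S.le)
  -- incomparability: the kernels coincide
  have h𝔮𝔯 : RingHom.ker (algebraMap (AdjoinRoot P) (Localization.AtPrime (𝔫'.comap ι))) =
      RingHom.ker ((algebraMap B (Localization.AtPrime 𝔫')).comp ι) := by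
    by_contra hne
    have hlt := lt_of_le_of_ne h𝔮le hne
    have := Ideal.IsIntegral.comap_lt_comap (R := S) hlt
    rw [h𝔮S, h𝔯S] at this
    exact lt_irrefl _ this
  -- conclusion
  rw [injective_iff_map_eq_zero]
  intro t ht
  obtain ⟨⟨a, s⟩, rfl⟩ := IsLocalization.mk'_surjective (𝔫'.comap ι).primeCompl t
  dsimp only at ht ⊢
  have hga : g (algebraMap (AdjoinRoot P) _ a) = 0 := by
    rw [IsLocalization.mk'_eq_mul_mk'_one, map_mul] at ht
    have hunit : IsUnit (g (IsLocalization.mk' (Localization.AtPrime (𝔫'.comap ι)) (1 : AdjoinRoot P) s)) := by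
      refine IsUnit.map g (IsUnit.of_mul_eq_one (algebraMap (AdjoinRoot P) _ (s : AdjoinRoot P)) ?_)
      rw [IsLocalization.mk'_spec, map_one]
    exact hunit.mul_left_eq_zero.mp ht
  have ha𝔯 : a ∈ RingHom.ker ((algebraMap B (Localization.AtPrime 𝔫')).comp ι) := by
    rw [RingHom.mem_ker, ← hg, RingHom.comp_apply]
    exact hga
  rw [← h𝔮𝔯, RingHom.mem_ker] at ha𝔯
  rw [IsLocalization.mk'_eq_mul_mk'_one, ha𝔯, zero_mul]

end Summit.ResolutionOfSingularities.ResolutionOfSingularities.Theorems.SwitchingDichotomy.EtaleLift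

end
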